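import Summits.QuantumAdvantage.AdviceFreeQNC0.WalkGapNaming
import Mathlib.Data.Nat.Choose.Sum
import HarnessLib

/-!
# Cell qa-qnc0 (odd primes `p ≥ 5`, route `OddPrimeWalk` crux `ShotsOdd`): toolkit III — sparse patterns, surgery, averaging

Planner qa-qnc0-p2 g14, route pack `OddPrimeWalk` (item `ShotsOdd`, "random cut-free surgery + truncated
inclusion–exclusion degree ≤ B·D + the fibre lemma + `elimLevelSqrtF`").  PROVED here (every field / every `p`):

* **`GapFibre.ind_mem_lowDeg_of_sparsePattern`** — the SPARSE PATTERN-DEGREE LEMMA: a Boolean function of the bits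
  `(h_g)_{g ∈ A}`, each with an indicator of degree `≤ D`, such that AT MOST `B` of the bits are on at any point, has
  an indicator of degree `≤ B·D` — however large `A` is.  Mechanism: the truncated Möbius expansion
  `patInd B A h S = Σ_{U ⊆ A∖S, |S ∪ U| ≤ B} (−1)^{|U|}·Π_{g ∈ S∪U}[h_g]` equals the pattern indicator `[pat = S]`
  (`patInd_apply`, inclusion–exclusion `Finset.sum_powerset_neg_one_pow_card`; the dropped terms vanish identically);
* `namedRes_levelSet_mem_lowDeg_shots` — with `≤ B` shots per input, the level sets of the fibre's named residue have
  `𝔽_p`-degree `≤ B·D`;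
* `GapFibre.surgery i L y` — zero the cuts strictly inside `(i, i+L)`: cut-free (`cutFree_surgery`), same degree,
  no more shots, and the win bit is unchanged at inputs firing nothing inside (`ringWinU_surgery_eq`);
* **`GapFibre.exists_quiet_interval`** — AVERAGING: among `m` disjoint length-`L` intervals one is entered by the
  shots of at most `B·2ⁿ/m` inputs (`card_entered_le`: the intervals entered by a set of cuts are at most its size,
  via `g ↦ g / L`).

The assembly `WalkHardFShots p` is `WalkHardFShots.lean`.  WHAT THIS IS NOT: nothing on the dense residual
`DenseResidualOdd`; separation NOT moved.
-/

noncomputable section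

namespace Summit.QuantumAdvantage.AdviceFreeQNC0

open Classical
open Finset
open Literature.Computability.MetaComplexity Literature.Computability.MetaComplexity.Smolensky

variable {n : ℕ}

/-! ## SHOTS: per-input-sparse strategies (≤ B shots on every input) -/

namespace GapFibre

/-! ### The truncated pattern expansion: functions of a `B`-sparse pattern have degree `≤ B·D` -/

section Sparse

variable {F : Type*} [Field F] {L : ℕ} {ι : Type*}

/-- The pattern of `z`: the indices in `A` whose bit `h g z` is on. -/
def pat (A : Finset ι) (h : ι → (Fin L → Bool) → Bool) (z : Fin L → Bool) : Finset ι :=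
  A.filter fun g => h g z = true

/-- The monomial of a set of pattern bits: `π_T(z) = Π_{g ∈ T} [h g z]`. -/
def patMono (h : ι → (Fin L → Bool) → Bool) (T : Finset ι) : (Fin L → Bool) → F :=
  ∏ g ∈ T, fun z => if h g z = true then (1 : F) else 0

/-- `π_T(z) = [T ⊆ pat z]` for `T ⊆ A`. -/
theorem patMono_apply (A : Finset ι) (h : ι → (Fin L → Bool) → Bool) {T : Finset ι} (hT : T ⊆ A)
    (z : Fin L → Bool) : patMono (F := F) h T z = if T ⊆ pat A h z then 1 else 0 := by
  unfold patMono
  rw [Finset.prod_apply]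
  by_cases hsub : T ⊆ pat A h z
  · rw [if_pos hsub]
    refine Finset.prod_eq_one fun g hg => ?_
    have := hsub hg
    unfold pat at this; rw [mem_filter] at this
    simp only [this.2, if_true]
  · rw [if_neg hsub]
    obtain ⟨g, hgT, hgn⟩ := Finset.not_subset.1 hsub
    refine Finset.prod_eq_zero hgT ?_
    have hne : ¬ h g z = true := fun hh => hgn (by unfold pat; rw [mem_filter]; exact ⟨hT hgT, hh⟩)
    simp [hne]

/-- Degree of a pattern monomial. -/
theorem patMono_mem_lowDeg {D : ℕ} (A : Finset ι) (h : ι → (Fin L → Bool) → Bool)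
    (hh : ∀ g ∈ A, (fun z => if h g z = true then (1 : F) else 0) ∈ lowDeg F L D)
    {T : Finset ι} (hT : T ⊆ A) : patMono (F := F) h T ∈ lowDeg F L (T.card * D) := by
  unfold patMono
  exact prod_mem_lowDeg T (fun g hg => hh g (hT hg))

/-- The TRUNCATED Möbius expansion of the pattern indicator `[pat z = S]`:
`Σ_{U ⊆ A \ S, |S ∪ U| ≤ B} (−1)^{|U|} π_{S ∪ U}`. -/
def patInd (B : ℕ) (A : Finset ι) (h : ι → (Fin L → Bool) → Bool) (S : Finset ι) : (Fin L → Bool) → F :=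
  ∑ U ∈ (A \ S).powerset.filter (fun U => (S ∪ U).card ≤ B), ((-1 : F) ^ U.card) • patMono h (S ∪ U)

/-- Degree of the truncated expansion: `≤ B·D`. -/
theorem patInd_mem_lowDeg {D B : ℕ} (A : Finset ι) (h : ι → (Fin L → Bool) → Bool)
    (hh : ∀ g ∈ A, (fun z => if h g z = true then (1 : F) else 0) ∈ lowDeg F L D) {S : Finset ι}
    (hS : S ⊆ A) : patInd (F := F) B A h S ∈ lowDeg F L (B * D) := by
  unfold patInd
  refine Submodule.sum_mem _ fun U hU => Submodule.smul_mem _ _ ?_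
  rw [mem_filter, Finset.mem_powerset] at hU
  have hSU : S ∪ U ⊆ A := Finset.union_subset hS (fun g hg => (Finset.mem_sdiff.1 (hU.1 hg)).1)
  exact lowDeg_mono (Nat.mul_le_mul_right _ hU.2) (patMono_mem_lowDeg A h hh hSU)

/-- **The truncated expansion IS the pattern indicator** when every pattern has at most `B` elements:
`patInd B A h S z = [pat z = S]`. -/
theorem patInd_apply {B : ℕ} (A : Finset ι) (h : ι → (Fin L → Bool) → Bool)
    (hB : ∀ z, (pat A h z).card ≤ B) {S : Finset ι} (hS : S ⊆ A) (z : Fin L → Bool) :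
    patInd (F := F) B A h S z = if pat A h z = S then 1 else 0 := by
  unfold patInd
  rw [Finset.sum_apply]
  have hpatA : pat A h z ⊆ A := Finset.filter_subset _ _
  -- drop the truncation: terms with `|S ∪ U| > B` vanish at `z`
  have hterm : ∀ U ∈ (A \ S).powerset,
      (((-1 : F) ^ U.card) • patMono (F := F) h (S ∪ U)) z =
        if S ∪ U ⊆ pat A h z then (-1 : F) ^ U.card else 0 := by
    intro U hU
    rw [Finset.mem_powerset] at hU
    have hSU : S ∪ U ⊆ A := Finset.union_subset hS (fun g hg => (Finset.mem_sdiff.1 (hU hg)).1)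
    rw [Pi.smul_apply, patMono_apply A h hSU, smul_eq_mul]
    split_ifs <;> simp
  rw [Finset.sum_filter]
  have hstep : ∀ U ∈ (A \ S).powerset,
      (if (S ∪ U).card ≤ B then (((-1 : F) ^ U.card) • patMono (F := F) h (S ∪ U)) z else 0) =
        if S ∪ U ⊆ pat A h z then (-1 : F) ^ U.card else 0 := by
    intro U hU
    by_cases hle : (S ∪ U).card ≤ B
    · rw [if_pos hle, hterm U hU]
    · rw [if_neg hle, if_neg]
      intro hsub
      exact hle (le_trans (Finset.card_le_card hsub) (hB z))
  rw [Finset.sum_congr rfl hstep]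
  -- now a plain inclusion–exclusion over `U ⊆ A \ S`
  by_cases hSz : S ⊆ pat A h z
  · have hsplit : ∀ U ∈ (A \ S).powerset,
        (if S ∪ U ⊆ pat A h z then (-1 : F) ^ U.card else 0) =
          if U ⊆ pat A h z \ S then (-1 : F) ^ U.card else 0 := by
      intro U hU
      rw [Finset.mem_powerset] at hU
      have hiff : S ∪ U ⊆ pat A h z ↔ U ⊆ pat A h z \ S := by
        constructor
        · intro hsub g hg
          rw [Finset.mem_sdiff]
          exact ⟨hsub (Finset.mem_union_right _ hg), (Finset.mem_sdiff.1 (hU hg)).2⟩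
        · intro hsub
          exact Finset.union_subset hSz (fun g hg => (Finset.mem_sdiff.1 (hsub hg)).1)
      simp only [hiff]
    rw [Finset.sum_congr rfl hsplit, ← Finset.sum_filter]
    have hfilt : ((A \ S).powerset.filter fun U => U ⊆ pat A h z \ S) = (pat A h z \ S).powerset := by
      ext U
      rw [mem_filter, Finset.mem_powerset, Finset.mem_powerset]
      constructor
      · exact fun hU => hU.2
      · intro hU
        exact ⟨fun g hg => Finset.mem_sdiff.2
          ⟨hpatA (Finset.mem_sdiff.1 (hU hg)).1, (Finset.mem_sdiff.1 (hU hg)).2⟩, hU⟩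
    rw [hfilt]
    have hie : (∑ U ∈ (pat A h z \ S).powerset, (-1 : F) ^ U.card) =
        if pat A h z \ S = ∅ then 1 else 0 := by
      have hz := Finset.sum_powerset_neg_one_pow_card (x := pat A h z \ S)
      have hcast : (∑ U ∈ (pat A h z \ S).powerset, (-1 : F) ^ U.card) =
          ((∑ U ∈ (pat A h z \ S).powerset, (-1 : ℤ) ^ U.card : ℤ) : F) := by push_cast; rfl
      rw [hcast, hz]; split_ifs <;> simp
    rw [hie]
    by_cases heq : pat A h z = S
    · rw [if_pos heq, if_pos (by rw [heq, Finset.sdiff_self])]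
    · rw [if_neg heq, if_neg]
      intro hemp
      apply heq
      exact Finset.Subset.antisymm (fun g hg => by
        by_contra hgS
        have : g ∈ pat A h z \ S := Finset.mem_sdiff.2 ⟨hg, hgS⟩
        rw [hemp] at this; exact Finset.notMem_empty g this) hSz
  · -- `S ⊄ pat z`: every term vanishes and `pat z ≠ S`
    rw [Finset.sum_eq_zero (fun U _ => by
      rw [if_neg (fun hsub => hSz (le_trans Finset.subset_union_left hsub))])]
    rw [if_neg (fun hpe => hSz (le_of_eq hpe.symm))]

/-- **Sparse pattern-degree lemma** (any field): if `f z` depends only on the bits `(h g z)_{g ∈ A}`, each `h g` has an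
indicator of degree `≤ D`, and AT MOST `B` of the bits are on at any `z`, then `f` has an indicator of degree `≤ B·D`
(however large `A` is). -/
theorem ind_mem_lowDeg_of_sparsePattern {D B : ℕ} (A : Finset ι) (h : ι → (Fin L → Bool) → Bool)
    (hh : ∀ g ∈ A, (fun z => if h g z = true then (1 : F) else 0) ∈ lowDeg F L D)
    (hB : ∀ z, (pat A h z).card ≤ B)
    (f : (Fin L → Bool) → Bool) (hf : ∀ z z', (∀ g ∈ A, h g z = h g z') → f z = f z') :
    (fun z => if f z = true then (1 : F) else 0) ∈ lowDeg F L (B * D) := by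
  -- realised true patterns
  obtain ⟨P, hP⟩ : ∃ P : Finset (Finset ι), P = A.powerset.filter fun S =>
    ∃ z : Fin L → Bool, pat A h z = S ∧ f z = true := ⟨_, rfl⟩
  have hPmem : ∀ S : Finset ι, S ∈ P ↔ S ⊆ A ∧ ∃ z : Fin L → Bool, pat A h z = S ∧ f z = true := fun S => by
    rw [hP, mem_filter, Finset.mem_powerset]
  have hpat_dep : ∀ z z', pat A h z = pat A h z' → f z = f z' := by
    intro z z' hzz'
    refine hf z z' fun g hg => ?_
    have h1 : h g z = true ↔ g ∈ pat A h z := by unfold pat; rw [mem_filter]; exact ⟨fun hh => ⟨hg, hh⟩, fun hh => hh.2⟩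
    have h2 : h g z' = true ↔ g ∈ pat A h z' := by unfold pat; rw [mem_filter]; exact ⟨fun hh => ⟨hg, hh⟩, fun hh => hh.2⟩
    rw [hzz'] at h1
    rcases Bool.eq_false_or_eq_true (h g z) with ha | ha <;>
      rcases Bool.eq_false_or_eq_true (h g z') with hb | hb
    · rw [ha, hb]
    · exact absurd (h1.1 ha) (fun hm => by rw [← h2] at hm; rw [hm] at hb; exact Bool.false_ne_true hb.symm)
    · exact absurd (h2.1 hb) (fun hm => by rw [← h1] at hm; rw [hm] at ha; exact Bool.false_ne_true ha.symm)
    · rw [ha, hb]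
  have heq : (fun z => if f z = true then (1 : F) else 0) = ∑ S ∈ P, patInd (F := F) B A h S := by
    funext z
    rw [Finset.sum_apply]
    have hterm : ∀ S ∈ P, patInd (F := F) B A h S z = if pat A h z = S then 1 else 0 :=
      fun S hS => patInd_apply A h hB ((hPmem S).1 hS).1 z
    rw [Finset.sum_congr rfl hterm]
    by_cases hfz : f z = true
    · rw [if_pos hfz]
      have hmem : pat A h z ∈ P := (hPmem _).2 ⟨Finset.filter_subset _ _, z, rfl, hfz⟩
      rw [← Finset.add_sum_erase P _ hmem, if_pos rfl, Finset.sum_eq_zero (fun S hS => ?_), add_zero]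
      rw [Finset.mem_erase] at hS
      rw [if_neg (fun h' => hS.1 h'.symm)]
    · rw [if_neg hfz]
      refine (Finset.sum_eq_zero fun S hS => ?_).symm
      rw [if_neg]
      intro hzS
      obtain ⟨_, z', hz', hfz'⟩ := (hPmem S).1 hS
      exact hfz ((hpat_dep z z' (hzS.trans hz'.symm)) ▸ hfz' |> fun h' => by rw [hpat_dep z z' (hzS.trans hz'.symm)]; exact hfz')
  rw [heq]
  exact Submodule.sum_mem _ fun S hS => patInd_mem_lowDeg A h hh ((hPmem S).1 hS).1

end Sparse

/-- **Level sets of the naming function, SHOTS form**: if every input fires at most `B` cuts, the level sets of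
`z ↦ namedRes (ow u z)` have `𝔽_p`-degree `≤ B·D`. -/
theorem namedRes_levelSet_mem_lowDeg_shots {p : ℕ} [Fact p.Prime] {i L c D B : ℕ}
    (y : Fin (n + 1) → (Fin n → Bool) → Bool) (hdeg : ∀ g, HasDegF p (y g) D)
    (hshots : ∀ u : Fin n → Bool, (univ.filter fun g : Fin (n + 1) => y g u = true).card ≤ B)
    (u : Fin n → Bool) (r : ℕ) :
    (fun z : Fin L → Bool => if namedRes i L c y u z % 3 = r % 3 then (1 : ZMod p) else 0) ∈
      lowDeg (ZMod p) L (B * D) := by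
  have h := ind_mem_lowDeg_of_sparsePattern (F := ZMod p) (B := B) (activeCuts y) (fun g z => y g (ow i L u z))
    (fun g _ => ind_comp_ow_mem_lowDeg u (hdeg g))
    (fun z => le_trans (Finset.card_le_card (fun g hg => by
      unfold pat at hg; rw [mem_filter] at hg ⊢; exact ⟨mem_univ _, hg.2⟩)) (hshots (ow i L u z)))
    (fun z => decide (namedRes i L c y u z % 3 = r % 3))
    (fun z z' hzz' => by
      unfold namedRes
      rw [R_congr i L c (activeCuts y) u (Y := fun g => y g (ow i L u z))
        (Y' := fun g => y g (ow i L u z')) hzz'])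
  refine (congrArg (· ∈ lowDeg (ZMod p) L (B * D)) ?_).mpr h
  funext z
  simp only [decide_eq_true_eq]

/-! ### Surgery: zeroing the cuts strictly inside an interval -/

/-- Zero the selections of the cuts strictly inside `(i, i+L)`. -/
def surgery (i L : ℕ) (y : Fin (n + 1) → (Fin n → Bool) → Bool) : Fin (n + 1) → (Fin n → Bool) → Bool :=
  fun g u => if i < g.val ∧ g.val < i + L then false else y g u

/-- The operated strategy is cut-free on `[i, i+L)`. -/
theorem cutFree_surgery (i L : ℕ) (y : Fin (n + 1) → (Fin n → Bool) → Bool) : CutFree i L (surgery i L y) := by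
  intro g hg
  unfold activeCuts at hg
  rw [mem_filter] at hg
  obtain ⟨u, hu⟩ := hg.2
  unfold surgery at hu
  by_cases h : i < g.val ∧ g.val < i + L
  · rw [if_pos h] at hu; exact absurd hu Bool.false_ne_true
  · omega

/-- Surgery does not raise the degree. -/
theorem hasDegF_surgery {p : ℕ} [Fact p.Prime] {D : ℕ} (i L : ℕ) {y : Fin (n + 1) → (Fin n → Bool) → Bool}
    (hdeg : ∀ g, HasDegF p (y g) D) (g : Fin (n + 1)) : HasDegF p (surgery i L y g) D := by
  unfold surgery HasDegF
  by_cases h : i < g.val ∧ g.val < i + L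
  · simp only [h, and_self, if_true]
    have : (fun _ : Fin n → Bool => if false = true then (1 : ZMod p) else 0) = 0 := by funext u; simp
    rw [this]; exact Submodule.zero_mem _
  · simp only [h, if_false]
    exact hdeg g

/-- Surgery does not add shots. -/
theorem shots_surgery_le (i L : ℕ) (y : Fin (n + 1) → (Fin n → Bool) → Bool) (u : Fin n → Bool) :
    (univ.filter fun g : Fin (n + 1) => surgery i L y g u = true).card ≤
      (univ.filter fun g : Fin (n + 1) => y g u = true).card := by
  refine Finset.card_le_card fun g hg => ?_
  rw [mem_filter] at hg ⊢
  refine ⟨hg.1, ?_⟩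
  have h2 := hg.2
  unfold surgery at h2
  by_cases h : i < g.val ∧ g.val < i + L
  · rw [if_pos h] at h2; exact absurd h2 Bool.false_ne_true
  · rw [if_neg h] at h2; exact h2

/-- If `u` fires no cut strictly inside the interval, the surgery does not change the win bit at `u`. -/
theorem ringWinU_surgery_eq (i L c : ℕ) (y : Fin (n + 1) → (Fin n → Bool) → Bool) (u : Fin n → Bool)
    (hu : ∀ g : Fin (n + 1), i < g.val ∧ g.val < i + L → y g u = false) :
    ringWinU c (surgery i L y) u = ringWinU c y u := by
  unfold ringWinU
  have hset : (univ.filter fun g : Fin (n + 1) =>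
      surgery i L y g u = true ∧ (c + g.val + walkExp u g.val) % 3 ≠ 0) =
      univ.filter fun g : Fin (n + 1) => y g u = true ∧ (c + g.val + walkExp u g.val) % 3 ≠ 0 := by
    refine Finset.filter_congr fun g _ => ?_
    unfold surgery
    by_cases h : i < g.val ∧ g.val < i + L
    · rw [if_pos h, hu g h]
    · rw [if_neg h]
  rw [hset]

/-- The number of length-`L` intervals `[kL, kL+L)`, `k < m`, STRICTLY entered by a cut of `S` is at most `|S|`. -/
theorem card_entered_le (L m : ℕ) (S : Finset (Fin (n + 1))) :
    ((Finset.range m).filter fun k => ∃ g ∈ S, k * L < g.val ∧ g.val < k * L + L).card ≤ S.card := by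
  rcases Nat.eq_zero_or_pos L with hL | hL
  · subst hL
    rw [Finset.card_eq_zero.2]
    · exact Nat.zero_le _
    · rw [Finset.eq_empty_iff_forall_notMem]
      intro k hk
      rw [mem_filter] at hk
      obtain ⟨g, _, h1, h2⟩ := hk.2
      omega
  · calc ((Finset.range m).filter fun k => ∃ g ∈ S, k * L < g.val ∧ g.val < k * L + L).card
        ≤ (S.image fun g : Fin (n + 1) => g.val / L).card := by
          refine Finset.card_le_card fun k hk => ?_
          rw [mem_filter] at hk
          obtain ⟨g, hgS, h1, h2⟩ := hk.2
          rw [Finset.mem_image]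
          refine ⟨g, hgS, ?_⟩
          have hlo : k * L ≤ g.val := h1.le
          have hhi : g.val < (k + 1) * L := by rw [Nat.add_mul, one_mul]; exact h2
          exact Nat.div_eq_of_lt_le hlo hhi
      _ ≤ S.card := Finset.card_image_le

/-- **Averaging**: among the `m ≥ 1` disjoint intervals `[kL, (k+1)L)`, one is entered (strictly) by the shots of at
most `B·2ⁿ/m` inputs, when every input fires at most `B` cuts. -/
theorem exists_quiet_interval {B : ℕ} (L m : ℕ) (hm : 0 < m) (y : Fin (n + 1) → (Fin n → Bool) → Bool)
    (hshots : ∀ u : Fin n → Bool, (univ.filter fun g : Fin (n + 1) => y g u = true).card ≤ B) :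
    ∃ k : ℕ, k < m ∧ m * (univ.filter fun u : Fin n → Bool =>
      ∃ g : Fin (n + 1), (k * L < g.val ∧ g.val < k * L + L) ∧ y g u = true).card ≤ B * 2 ^ n := by
  -- the double count of the pairs (k, u) with a shot of `u` strictly inside interval `k`
  have hswap : (∑ k ∈ Finset.range m, (univ.filter fun u : Fin n → Bool =>
      ∃ g : Fin (n + 1), (k * L < g.val ∧ g.val < k * L + L) ∧ y g u = true).card) =
      ∑ u : Fin n → Bool, ((Finset.range m).filter fun k =>
        ∃ g : Fin (n + 1), (k * L < g.val ∧ g.val < k * L + L) ∧ y g u = true).card := by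
    have h1 : ∀ k, (univ.filter fun u : Fin n → Bool =>
        ∃ g : Fin (n + 1), (k * L < g.val ∧ g.val < k * L + L) ∧ y g u = true).card =
        ∑ u : Fin n → Bool, if (∃ g : Fin (n + 1), (k * L < g.val ∧ g.val < k * L + L) ∧ y g u = true)
          then 1 else 0 := fun k => by rw [Finset.card_eq_sum_ones, Finset.sum_filter]
    have h2 : ∀ u : Fin n → Bool, ((Finset.range m).filter fun k =>
        ∃ g : Fin (n + 1), (k * L < g.val ∧ g.val < k * L + L) ∧ y g u = true).card =
        ∑ k ∈ Finset.range m, if (∃ g : Fin (n + 1), (k * L < g.val ∧ g.val < k * L + L) ∧ y g u = true)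
          then 1 else 0 := fun u => by rw [Finset.card_eq_sum_ones, Finset.sum_filter]
    simp_rw [h1, h2]
    exact Finset.sum_comm
  have hsum : (∑ k ∈ Finset.range m, (univ.filter fun u : Fin n → Bool =>
      ∃ g : Fin (n + 1), (k * L < g.val ∧ g.val < k * L + L) ∧ y g u = true).card) ≤ B * 2 ^ n := by
    rw [hswap]
    calc ∑ u : Fin n → Bool, ((Finset.range m).filter fun k =>
          ∃ g : Fin (n + 1), (k * L < g.val ∧ g.val < k * L + L) ∧ y g u = true).card
        ≤ ∑ u : Fin n → Bool, (univ.filter fun g : Fin (n + 1) => y g u = true).card := by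
          refine Finset.sum_le_sum fun u _ => le_trans (Finset.card_le_card fun k hk => ?_)
            (card_entered_le L m (univ.filter fun g : Fin (n + 1) => y g u = true))
          rw [mem_filter] at hk ⊢
          obtain ⟨g, hg, hy⟩ := hk.2
          exact ⟨hk.1, g, by rw [mem_filter]; exact ⟨mem_univ _, hy⟩, hg⟩
      _ ≤ ∑ _u : Fin n → Bool, B := Finset.sum_le_sum fun u _ => hshots u
      _ = B * 2 ^ n := by
          rw [Finset.sum_const, Finset.card_univ, Fintype.card_fun, Fintype.card_bool, Fintype.card_fin,
            smul_eq_mul, mul_comm]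
  by_contra hcon
  push Not at hcon
  have hlt : m * (B * 2 ^ n) < m * (B * 2 ^ n) := by
    calc m * (B * 2 ^ n) = ∑ _k ∈ Finset.range m, B * 2 ^ n := by
          rw [Finset.sum_const, Finset.card_range, smul_eq_mul]
      _ < ∑ k ∈ Finset.range m, m * (univ.filter fun u : Fin n → Bool =>
          ∃ g : Fin (n + 1), (k * L < g.val ∧ g.val < k * L + L) ∧ y g u = true).card :=
          Finset.sum_lt_sum_of_nonempty (by rw [Finset.nonempty_range_iff]; omega)
            (fun k hk => hcon k (Finset.mem_range.1 hk))
      _ = m * ∑ k ∈ Finset.range m, (univ.filter fun u : Fin n → Bool =>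
          ∃ g : Fin (n + 1), (k * L < g.val ∧ g.val < k * L + L) ∧ y g u = true).card := by
          rw [Finset.mul_sum]
      _ ≤ m * (B * 2 ^ n) := Nat.mul_le_mul_left _ hsum
  exact lt_irrefl _ hlt

end GapFibre


end Summit.QuantumAdvantage.AdviceFreeQNC0

end
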